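import Summits.BirchSwinnertonDyer.BirchSwinnertonDyer.Theorems.TwoAdicConverseOrdLambdaHalfAtTwoGreenbergTameQuotientFinite
import Literature.NumberTheory.IwasawaTheory.ClassicalMuVanishesUnramifiedClasses
import Literature.NumberTheory.EllipticCurves.HeegnerPointsImaginaryQuadraticProofs
import HarnessLib

/-!
# Route `TwoAdicConverse` (rung S3), crux `OrdLambdaHalfAtTwo` (item stmt-BirchSwinnertonDyer-19556), line
# `kato-determinant-greenberg-two`: the registered `GL(1)` residual stub from TWO PRINT FACTS and the `w̄`-step

Cell `bsd-2adic`, seat `bsd-2adic-conv-1` GEN 25 (`--supports` stmt-BirchSwinnertonDyer-19556; helper; pen RC-310 (4b), «the by-name closing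
file»).  Seventh file of the B2 spine.  The registered stub `stub_residualGL1FinitenessAtTwo` of skeleton v2/v2.1 reads

  `∀ K imaginary quadratic, κ cyclotomic ℤ₂-extension, w ∣ 2, Σ finite, M a discrete Γ_K-module of order 2:
     (datumStrictSelmer (ker κ) M 2 (bdpData M 2 w) Σ).Finite`.

By p661729 (`…GL1Reduction`) + p663165 (`…TameQuotientFinite`, the tame input PROVED) it follows from [P1] ∧ [C]; here [P1] is supplied
BY NAME from the two Literature facts the pen's ruling RC-310 names — `ferreroWashington1979_classicalMuVanishes` (Ferrero–Washington,
growth form; `ClassicalMuInvariant.lean`) and `classicalMuVanishes_finite_unramifiedClasses` (Iwasawa's `μ = 0` in character form;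
`ClassicalMuVanishesUnramifiedClasses.lean`, p662555) — through the glue «imaginary quadratic ⟹ abelian over `ℚ` and totally complex»,
so that the stub is EXACTLY

  `stub_residualGL1FinitenessAtTwo ⟸ ferreroWashington1979_classicalMuVanishes ∧ classicalMuVanishes_finite_unramifiedClasses ∧ [C]`

(`residualGL1Finiteness_of_print_of_wbarStep`, binders of the stub verbatim), with [C] = the `w̄`-STEP in the shape the lead can register as
`stub_wbarStepAtTwo` (NOTE-19556-GL1res-conv1-g25 §1(a): reciprocity for `K_n` and `ℚ_n` + Kronecker–Weber + Nakayama; kernel-blocked on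
class field theory; not verbatim in print).  Also: B2 on habitat (β) for an imaginary quadratic `K` from the same three inputs.

* `isAbelianGalois_of_isImaginaryQuadratic` — a quadratic extension of `ℚ` is abelian Galois (Mathlib `IsQuadraticExtension.isGalois`,
  `.isCyclic`, `IsAbelianGalois.of_isCyclic`);
* `finite_unramifiedClasses_of_print` — [P1] for an imaginary quadratic `K`, its cyclotomic `ℤ₂`-extension and a trivial module of order `2`,
  from the two facts;
* **`residualGL1Finiteness_of_print_of_wbarStep`** — the registered stub's statement from the two facts and [C];
* `greenbergStrictSelmerDual_finite_torsion_mu_on_beta_of_print_of_wbarStep` — B2 on (β).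

HONEST FRAMING.  Composition; no definition, no `sorry`; two PRINT named facts and the `w̄`-step are displayed hypotheses (the theorems
are CONDITIONAL on them, `proof.conditional`); nothing about any particular curve is asserted; BSD is not proved by any of this.
PARTITION (D-0054): none — RANK axis S3 × X5@2 stratum (β).

References: B. Ferrero, L. Washington, Ann. of Math. 109 (1979) [FerreroWashington1979]; S. Lang, GTM 121 Ch. 5 [Lang1990]; J.-F. Jaulent,
C. Maire, Canad. Math. Bull. 46 (2003) [JaulentMaire2003].
-/

set_option linter.dupNamespace false
set_option autoImplicit false

noncomputable section

open scoped Classical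

namespace Summit.BirchSwinnertonDyer.BirchSwinnertonDyer.Theorems.TwoAdicGreenbergCotorsion

open NumberField IsDedekindDomain Field WeierstrassCurve
open Literature Literature.NumberTheory.EllipticCurves Literature.NumberTheory.EllipticCurves.GreenbergSelmer
  Literature.NumberTheory.EllipticCurves.GreenbergVatsal2000 Literature.NumberTheory.GaloisRepresentations
  Literature.NumberTheory.IwasawaTheory
  Summit.BirchSwinnertonDyer.Rank1Residual.X11b Summit.BirchSwinnertonDyer.Rank1Residual.X11b.AcSelmer
  Summit.BirchSwinnertonDyer.Rank1Residual.X2.ResidualDevissageModules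

/-! ## §1 Glue: imaginary quadratic fields are abelian over `ℚ` -/

/-- A quadratic extension of `ℚ` is abelian Galois (degree `2`: normal, separable, cyclic Galois group). [folklore] -/
theorem isAbelianGalois_of_isImaginaryQuadratic {K : Type} [Field K] [NumberField K] (hK : IsImaginaryQuadratic K) :
    IsAbelianGalois ℚ K := by
  haveI : Algebra.IsQuadraticExtension ℚ K := ((isImaginaryQuadratic_iff_isQuadraticExtension).mp hK).1
  exact IsAbelianGalois.of_isCyclic ℚ K

/-! ## §2 [P1] for the Greenberg fields, by name from the two print facts -/

/-- **[P1] from PRINT**: for an imaginary quadratic `K`, its cyclotomic `ℤ₂`-extension `κ` and a finite discrete `Γ_K`-module `M` of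
`2`-power order with trivial action, the everywhere-unramified classes of `H¹(ker κ, M)` form a finite set — Ferrero–Washington
(`ferreroWashington1979_classicalMuVanishes`: `μ = 0` in growth form for the abelian field `K`) + Iwasawa's dictionary
(`classicalMuVanishes_finite_unramifiedClasses`, binder `IsTotallyComplex K`). [cite: FerreroWashington1979] [cite: Lang1990, Ch. 5 §4 pp. 137–143] -/
theorem finite_unramifiedClasses_of_print (hFW : ferreroWashington1979_classicalMuVanishes)
    (hI : classicalMuVanishes_finite_unramifiedClasses)
    {K : Type} [Field K] [NumberField K] (hK : IsImaginaryQuadratic K) (κ : ZpExtension K 2) (hκ : κ.IsCyclotomic)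
    (M : Type) [AddCommGroup M] [DistribMulAction (absoluteGaloisGroup K) M] [TopologicalSpace M] [DiscreteTopology M]
    [Finite M] (hM : ∃ k : ℕ, Nat.card M = 2 ^ k) (htriv : ∀ (σ : absoluteGaloisGroup K) (m : M), σ • m = m) :
    {c : Literature.NumberTheory.EllipticCurves.subgroupH1 κ.kerSubgroup M |
      ∀ (v : HeightOneSpectrum (𝓞 K)) (σ : absoluteGaloisGroup K),
        Literature.NumberTheory.EllipticCurves.conjH1 κ.kerSubgroup M σ c ∈ unramifiedKer κ.kerSubgroup M v}.Finite := by
  haveI : Fact (Nat.Prime 2) := ⟨Nat.prime_two⟩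
  haveI : IsAbelianGalois ℚ K := isAbelianGalois_of_isImaginaryQuadratic hK
  exact hI K 2 κ (Or.inr hK.isTotallyComplex) (hFW K 2 κ hκ) M hM htriv

/-! ## §3 The registered stub from two print facts and the `w̄`-step -/

/-- **`stub_residualGL1FinitenessAtTwo ⟸ FW ∧ Iwasawa-dictionary ∧ [C]`** — the registered stub's statement (binders verbatim: every
imaginary quadratic `K`, cyclotomic `κ`, `w ∣ 2`, finite `Σ`, `Γ_K`-module `M` of order `2`) from the two PRINT facts and the `w̄`-STEP
`hC` (for every such `K, κ, w, M`: a class unramified at every `v ∤ 2` and trivial on every decomposition group above `w` is unramified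
at every place above `2`).  Composition: `finite_datumStrictSelmer_bdpData_cyclotomic_of_P1_of_C` (p663165: tame input proved; p661729:
reduction) with [P1] := `finite_unramifiedClasses_of_print`. [cite: JaulentMaire2003, Thm 12 and Example p. 189] [cite: FerreroWashington1979] -/
theorem residualGL1Finiteness_of_print_of_wbarStep (hFW : ferreroWashington1979_classicalMuVanishes)
    (hI : classicalMuVanishes_finite_unramifiedClasses)
    (hC : ∀ (K : Type) [Field K] [NumberField K], IsImaginaryQuadratic K →
      ∀ (κK : ZpExtension K 2), κK.IsCyclotomic →
      ∀ (w : HeightOneSpectrum (𝓞 K)) (hw : ((2 : ℕ) : 𝓞 K) ∈ w.asIdeal),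
      ∀ (M : Type) [AddCommGroup M] [DistribMulAction (absoluteGaloisGroup K) M]
        [TopologicalSpace M] [DiscreteTopology M], Nat.card M = 2 →
      ∀ c : Literature.NumberTheory.EllipticCurves.subgroupH1 κK.kerSubgroup M,
        c ∈ unramifiedOutside κK.kerSubgroup M 2 ∅ →
        (∀ σ : absoluteGaloisGroup K, Literature.NumberTheory.EllipticCurves.conjH1 κK.kerSubgroup M σ c ∈
          (AcSelmer.bdpData M 2 w w hw).strictKer κK.kerSubgroup) →
        ∀ (v : HeightOneSpectrum (𝓞 K)), ((2 : ℕ) : 𝓞 K) ∈ v.asIdeal →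
          ∀ σ : absoluteGaloisGroup K,
            Literature.NumberTheory.EllipticCurves.conjH1 κK.kerSubgroup M σ c ∈ unramifiedKer κK.kerSubgroup M v) :
    ∀ (K : Type) [Field K] [NumberField K], IsImaginaryQuadratic K →
      ∀ (κK : ZpExtension K 2), κK.IsCyclotomic →
      ∀ (w : HeightOneSpectrum (𝓞 K)), ((2 : ℕ) : 𝓞 K) ∈ w.asIdeal →
      ∀ (S : Set (HeightOneSpectrum (𝓞 K))), S.Finite →
      ∀ (M : Type) [AddCommGroup M] [DistribMulAction (absoluteGaloisGroup K) M]
        [TopologicalSpace M] [DiscreteTopology M], Nat.card M = 2 →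
        (datumStrictSelmer κK.kerSubgroup M 2 (AcSelmer.bdpData M 2 w) S :
          Set (Literature.NumberTheory.EllipticCurves.subgroupH1 κK.kerSubgroup M)).Finite := by
  intro K _ _ hK κK hκ w hw S hS M _ _ _ _ hM2
  haveI : Fact (Nat.Prime 2) := ⟨Nat.prime_two⟩
  haveI : Finite M := Nat.finite_of_card_ne_zero (by rw [hM2]; norm_num)
  have htriv : ∀ (σ : absoluteGaloisGroup K) (m : M), σ • m = m := fun σ m ↦ smul_eq_self_of_natCard_eq_two hM2 σ m
  exact finite_datumStrictSelmer_bdpData_cyclotomic_of_P1_of_C κK M w hw S ⟨1, by rw [hM2, pow_one]⟩ htriv hκ hS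
    (finite_unramifiedClasses_of_print hFW hI hK κK hκ M ⟨1, by rw [hM2, pow_one]⟩ htriv) (hC K hK κK hκ w hw M hM2)

/-! ## §4 B2 on (β) for the Greenberg fields from the same three inputs -/

variable (W : WeierstrassCurve ℚ) [W.IsElliptic] {K : Type} [Field K] [NumberField K]

/-- **B2 ON HABITAT (β) ⟸ FW ∧ Iwasawa-dictionary ∧ [C]** for an imaginary quadratic `K` (the line's Greenberg field), its cyclotomic
`ℤ₂`-extension with a topological generator, `w ∣ 2`, and `Σ` finite containing the bad places of `E_K` prime to `2`: every
Pontryagin-dual datum of the Greenberg (strict at `w`, relaxed elsewhere above `2`) Selmer group of `E_K[2^∞]` over `K_∞` is `Λ`-f.g.,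
`Λ`-torsion, `μ = 0`. [cite: CastellaGrossiLeeSkinner2022, §1.4 Props. 17–18] [cite: FerreroWashington1979] -/
theorem greenbergStrictSelmerDual_finite_torsion_mu_on_beta_of_print_of_wbarStep (hred : ¬ W.HasIrreducibleModPGaloisRep 2)
    (hFW : ferreroWashington1979_classicalMuVanishes) (hI : classicalMuVanishes_finite_unramifiedClasses)
    (hK : IsImaginaryQuadratic K) (κ : ZpExtension K 2) (hκ : κ.IsCyclotomic) {γ : absoluteGaloisGroup K} (hγ : κ.IsTopGenerator γ)
    {w : HeightOneSpectrum (𝓞 K)} (hw : ((2 : ℕ) : 𝓞 K) ∈ w.asIdeal)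
    {S : Set (HeightOneSpectrum (𝓞 K))} (hSfin : S.Finite)
    (hS : ∀ v : HeightOneSpectrum (𝓞 K), v ∉ S → ((2 : ℕ) : 𝓞 K) ∉ v.asIdeal → (W.baseChange K).HasGoodReductionAt v)
    (hC : ∀ (M : Type) [AddCommGroup M] [DistribMulAction (absoluteGaloisGroup K) M]
        [TopologicalSpace M] [DiscreteTopology M], Nat.card M = 2 →
      ∀ c : Literature.NumberTheory.EllipticCurves.subgroupH1 κ.kerSubgroup M,
        c ∈ unramifiedOutside κ.kerSubgroup M 2 ∅ →
        (∀ σ : absoluteGaloisGroup K, Literature.NumberTheory.EllipticCurves.conjH1 κ.kerSubgroup M σ c ∈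
          (AcSelmer.bdpData M 2 w w hw).strictKer κ.kerSubgroup) →
        ∀ (v : HeightOneSpectrum (𝓞 K)), ((2 : ℕ) : 𝓞 K) ∈ v.asIdeal →
          ∀ σ : absoluteGaloisGroup K,
            Literature.NumberTheory.EllipticCurves.conjH1 κ.kerSubgroup M σ c ∈ unramifiedKer κ.kerSubgroup M v)
    (D : (W.baseChange K).GreenbergStrictSelmerDualData κ γ (AcSelmer.bdpData _ 2 w)) :
    Module.Finite (IwasawaAlgebra 2) D.X ∧ Module.IsTorsion (IwasawaAlgebra 2) D.X ∧ muInvariant 2 D.X = 0 := by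
  haveI : Fact (Nat.Prime 2) := ⟨Nat.prime_two⟩
  refine greenbergStrictSelmerDual_finite_torsion_mu_on_beta_of_P1_of_C W hred κ hκ hγ hw hSfin hS (fun Φ hΦ2 ↦ ?_)
    (fun Φ hΦ2 ↦ hC Φ.Sub hΦ2) D
  haveI : Finite Φ.Sub := Nat.finite_of_card_ne_zero (by rw [hΦ2]; norm_num)
  exact finite_unramifiedClasses_of_print hFW hI hK κ hκ Φ.Sub ⟨1, by rw [hΦ2, pow_one]⟩
    (fun σ m ↦ smul_eq_self_of_natCard_eq_two hΦ2 σ m)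

end Summit.BirchSwinnertonDyer.BirchSwinnertonDyer.Theorems.TwoAdicGreenbergCotorsion

end
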